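import Literature.AlgebraicGeometry.ComplexMultiplication.RationalRepresentationTateComparison
import Literature.AlgebraicGeometry.Motives.AbelianVarietyQuasiIdempotentImageRank
import Literature.RingTheory.SimpleModule.EndomorphismAlgebraFullRankOneProjector
import Mathlib.RingTheory.TensorProduct.Free
import Mathlib.LinearAlgebra.Matrix.Rank
import HarnessLib

/-!
# Ranks in the rational representation: `rank ψ(x) = rank V_ℓ(x)` and `rank ψ(e) = 2 dim(Im u)` for a quasi-idempotent
# (Lang VII §2 Thm. 2.1; Mumford §19 Thm. 3; Shimura 1998 §5.1)

Layer `Literature/AlgebraicGeometry/ComplexMultiplication`, namespace `Literature.AlgebraicGeometry.ComplexMultiplication`.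

For an abelian variety `B` over `K` and a faithful rational representation `ψ : End⁰_K(B) → M_ι(ℚ)` with an `ℓ`-adic comparison
`c : ℚ_ℓ^ι ⥲ V_ℓ(B)`, `c ∘ (ψ x)_ℓ = V_ℓ(x) ∘ c` (`RationalRepresentationTateComparison.exists_ratRep_tateComparison`, (D2)), the rank of
the rational matrix `ψ(x)` (Mathlib `Matrix.rank`) is the `ℚ_ℓ`-rank of `V_ℓ(x)` (`rank_eq_finrank_range_rationalTateAction`: ranks are
invariant under extension of scalars `ℚ → ℚ_ℓ`, `rank_map_eq_rank`, and under conjugation by `c`).  With the tree's `ℓ`-adic rank of a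
quasi-idempotent (`AbelianVarietyQuasiIdempotentImageRank.finrank_range_rationalTateAction_eq_two_mul_dim`, (D4a)):

  `rank ψ(e) = 2 · dim(Im u)`  for `u ∈ End_K(B)`, `u² = a u`, `a ≠ 0`, `1 ⊗ u = a e`

(`rank_eq_two_mul_dim_image`), and packaged for a number field WITHOUT any `ℓ` (`exists_ratRep_rank_eq_two_mul_dim_image`, (D2a)+(D4)):
`∃ ι ψ, ψ injective ∧ #ι = 2 dim B ∧ ∀ u a e, u² = a u → a ≠ 0 → 1 ⊗ u = a e → rank ψ(e) = 2 dim(Im u)`.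

USE (cell `hodgecm-mathlib`, D-0151, crux `HLiu418` = stmt-HodgeConjecture-24832, d6 card S2′ degree road): the rank clause of
`RingTheory/SimpleModule/BlockModuleOfFaithfulRepresentation` reads `dim_ℚ range(act h) = rank ψ(ε h)`; this file turns it into
`2 · dim(Im u)`, the DEGREE side of the S2′ conjunct.
-/

noncomputable section

open CategoryTheory Module Function
open scoped Matrix TensorProduct
open Literature.AlgebraicGeometry.Motives Literature.AlgebraicGeometry.Motives.AbelianVariety

namespace Literature.AlgebraicGeometry.ComplexMultiplication

universe u

/-! ### §1 The rank of a matrix is invariant under extension of scalars -/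

section RankMap

variable {k : Type*} [Field k] (L : Type*) [Field L] [Algebra k L] {ι : Type*} [Fintype ι] [DecidableEq ι]

/-- **`rank (M ⊗ 1) = rank M`**: the rank of a square matrix is unchanged by an extension of scalars `k → L` (the matrix of
`(M·)_(L)` in the basis `1 ⊗ e_i` is `M` read in `L`, Mathlib `LinearMap.toMatrix_baseChange`; ranks of endomorphisms are base-change
invariant, ★ `RingTheory.SimpleModule.finrank_range_baseChange_eq`). [cite: BourbakiAlgebraI1989, Ch. II §7 no. 7 Proposition 14] -/
theorem rank_map_eq_rank (M : Matrix ι ι k) : (M.map (algebraMap k L)).rank = M.rank := by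
  set b := Pi.basisFun k ι with hb
  have hM : LinearMap.toMatrix (Algebra.TensorProduct.basis L b) (Algebra.TensorProduct.basis L b)
      ((Matrix.mulVecLin M).baseChange L) = M.map (algebraMap k L) := by
    rw [LinearMap.toMatrix_baseChange, hb, LinearMap.toMatrix_eq_toMatrix', ← Matrix.toLin'_apply', LinearMap.toMatrix'_toLin']
  rw [← hM, Matrix.rank_eq_finrank_range_toLin _ (Algebra.TensorProduct.basis L b) (Algebra.TensorProduct.basis L b),
    Matrix.toLin_toMatrix, Literature.RingTheory.SimpleModule.finrank_range_baseChange_eq]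
  rfl

end RankMap

/-! ### §2 `rank ψ(x) = rank_{ℚ_ℓ} V_ℓ(x)` along an `ℓ`-adic comparison -/

section Comparison

variable {K : Type u} [Field K] (B : AbelianVariety K) {ι : Type} [Fintype ι] [DecidableEq ι]
  (ψ : B.endAlgebra →ₐ[ℚ] Matrix ι ι ℚ) (ℓ : ℕ) [Fact ℓ.Prime] (c : (ι → ℚ_[ℓ]) ≃ₗ[ℚ_[ℓ]] B.rationalTateModule ℓ)
  (hc : ∀ x : B.endAlgebra,
    (c : (ι → ℚ_[ℓ]) →ₗ[ℚ_[ℓ]] B.rationalTateModule ℓ) ∘ₗ Matrix.mulVecLin ((ψ x).map (algebraMap ℚ ℚ_[ℓ])) =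
      (rationalTateAction B ℓ x : Module.End ℚ_[ℓ] (B.rationalTateModule ℓ)) ∘ₗ
        (c : (ι → ℚ_[ℓ]) →ₗ[ℚ_[ℓ]] B.rationalTateModule ℓ))

include hc in
/-- **`rank ψ(x) = dim_{ℚ_ℓ} range V_ℓ(x)`** for every `x ∈ End⁰_K(B)`, along an `ℓ`-adic comparison `c ∘ (ψ x)_ℓ = V_ℓ(x) ∘ c`
(`rank_map_eq_rank` for `ℚ → ℚ_ℓ`, then `range V_ℓ(x) = c(range (ψ x)_ℓ)`).
[cite: Lang1982AbelianFunctions, Ch. VII §2, Thm. 2.1, p. 116] [cite: MumfordAV1970, §19 Thm. 3 (p. 176)] -/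
theorem rank_eq_finrank_range_rationalTateAction (x : B.endAlgebra) :
    (ψ x).rank = finrank ℚ_[ℓ] (LinearMap.range (rationalTateAction B ℓ x)) := by
  rw [← rank_map_eq_rank ℚ_[ℓ] (ψ x), Matrix.rank]
  have h : LinearMap.range (rationalTateAction B ℓ x) =
      (LinearMap.range (Matrix.mulVecLin ((ψ x).map (algebraMap ℚ ℚ_[ℓ])))).map
        (c : (ι → ℚ_[ℓ]) →ₗ[ℚ_[ℓ]] B.rationalTateModule ℓ) := by
    rw [← LinearMap.range_comp, hc x, LinearMap.range_comp, LinearEquiv.range, Submodule.map_top]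
  rw [h, LinearEquiv.finrank_map_eq]

include hc in
/-- **`rank ψ(e) = 2 · dim(Im u)` for a quasi-idempotent `u`** (`u² = a u`, `a ≠ 0`, `1 ⊗ u = a • e` in `End⁰_K(B)`, `char K ∤ ℓ`):
`rank ψ(e) = rank V_ℓ(e)` (`rank_eq_finrank_range_rationalTateAction`) `= 2 dim(Im u)` (the tree's
`finrank_range_rationalTateAction_eq_two_mul_dim`). [cite: MumfordAV1970, §19 p. 172 and Thm. 3 (p. 176)]
[cite: Lang1982AbelianFunctions, Ch. VII §2, Thm. 2.1, p. 116] -/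
theorem rank_eq_two_mul_dim_image (hℓ : (ℓ : K) ≠ 0) {u : B ⟶ B} {a : ℕ} (hu : u ≫ u = a • u) (ha : a ≠ 0)
    {e : B.endAlgebra} (he : AbelianVariety.endAlgebra.of B u = (a : ℚ) • e) :
    (ψ e).rank = 2 * (AbelianVariety.image u).dim := by
  rw [rank_eq_finrank_range_rationalTateAction B ψ ℓ c hc e, finrank_range_rationalTateAction_eq_two_mul_dim ℓ hu ha hℓ he]

end Comparison

/-! ### §3 Packaged over a number field, `ℓ`-free -/

/-- **(D2a)+(D4), `ℓ`-free: over a number field `E`, `End⁰_E(B)` has a faithful rational representation `ψ` of size `2 dim B` in which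
every quasi-idempotent reads its image: `rank ψ(e) = 2 · dim(Im u)` whenever `u² = a u`, `a ≠ 0`, `1 ⊗ u = a • e`** (from
`exists_ratRep_tateComparison` at `ℓ = 2` and `rank_eq_two_mul_dim_image`). [cite: Lang1982AbelianFunctions, Ch. VII §2, Thm. 2.1, p. 116]
[cite: MumfordAV1970, §19 Thm. 3 (p. 176)] [cite: Shimura1998, §5.1 Proposition 1 (p. 36) and Propositions 3–4 (p. 37)] -/
theorem exists_ratRep_rank_eq_two_mul_dim_image {E : Type} [Field E] [NumberField E] (B : AbelianVariety E) :
    ∃ (ι : Type) (_ : Fintype ι) (_ : DecidableEq ι) (ψ : B.endAlgebra →ₐ[ℚ] Matrix ι ι ℚ),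
      Injective ψ ∧ Fintype.card ι = 2 * B.dim ∧
        ∀ (u : B ⟶ B) (a : ℕ) (e : B.endAlgebra), u ≫ u = a • u → a ≠ 0 →
          AbelianVariety.endAlgebra.of B u = (a : ℚ) • e → (ψ e).rank = 2 * (AbelianVariety.image u).dim := by
  obtain ⟨ι, _, _, ψ, hψ, hcard, hcmp⟩ := exists_ratRep_tateComparison B
  haveI : Fact (Nat.Prime 2) := ⟨Nat.prime_two⟩
  obtain ⟨c, hc⟩ := hcmp 2
  have h2 : ((2 : ℕ) : E) ≠ 0 := by exact_mod_cast (two_ne_zero : (2 : E) ≠ 0)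
  exact ⟨ι, inferInstance, inferInstance, ψ, hψ, hcard, fun u a e hu ha he ↦ rank_eq_two_mul_dim_image B ψ 2 c hc h2 hu ha he⟩

end Literature.AlgebraicGeometry.ComplexMultiplication

end
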